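import Summits.ResolutionOfSingularities.ResolutionOfSingularities.Theorems.ToricLadderCells
import HarnessLib

/-!
# ToricLadderKernels — decomp-res node «ToricLadder» (lens-1 g14 ArchimedeanLadder → g15 DensityLadder → g16
ToricLadder), tree file 2/5

Content VERBATIM from the decomp-res lens-1 g16 file `HOME/decomp-res-lens-1/g16/ToricLadder.lean` (sha256
67376591e05ef26e…; PARTS I–II =
g15 `DensityLadder.lean` @6c32844d l.120–1091 = g14 `ArchimedeanLadder.lean` PART I, all carried verbatim by the
lens), namespace renamed
`…Theses.ToricLadder` ↦ `…Theorems.ToricLadder` (ONE namespace for all five tree files so the lens's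
dot-notation and unqualified references
stay verbatim), `set_option` lines dropped.  HOME = run/shared/lean/pub/decomp-res.  Landed by decomp-res writer g6
as SUPPORT of the
Valuative route item 0641 `LuAlphaPTorsor` (critic rows 113/116 + order 2026-08-30T17:45:44Z: g16 supersedes g15 for
landing; lens-1 WRITER.md);
no Valuative route edit is made by the decomp-res cell (the located residual `NonToricArchLU 2 4` and the port
`ToricAscent 2` stay tree
definitions here, documented, for the Valuative tenure / operator to book).  Two elementary lemmas that restate
landed declarations are
deleted and cited BY NAME instead (gate dedup, p782367): `mem_of_mem_nonunits_of_le` (≡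
`WildSymbol.Birth.nonunits_subset_of_le`, whose module is not importable here) ↦ its one-line Mathlib proof
inlined at the single use, `algebraMap_mem_of_le` ↦
`Literature.AlgebraicGeometry.Resolution.algebraMap_mem_of_le`.

PART I §4 re-basing the ground field `LURel d → TransResidueLU (d + 1)`, §5 composite valuations `LURel d →
CompositeLU (d + 1)`,
§6 the ladder: split, floor, iteration — all PROVED.
(Sources: CossartPiltant2019; KnafKuhlmann2005 arXiv:math/0304159 Thm 4.1 + §4 remarks (1)–(3); KnafKuhlmann2009
arXiv:math/0702856 Prop 3.11, Thm 1.5; SanSaturnino2017 arXiv:1412.7697 Thm 7.5; NovacoskiSpivakovsky2014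
arXiv:1204.4751; ZariskiSamuelII.)
-/

noncomputable section

open IsLocalRing Literature.AlgebraicGeometry.Resolution
open Summit.ResolutionOfSingularities.ResolutionOfSingularities.Theses
open Summit.ResolutionOfSingularities.ResolutionOfSingularities.Theorems
open Summit.ResolutionOfSingularities.ResolutionOfSingularities.Theorems.PfaffLine

namespace Summit.ResolutionOfSingularities.ResolutionOfSingularities.Theorems.ToricLadder

/-! ## 4. Re-basing the ground field: `LURel d → TransResidueLU (d + 1)` -/

section Rebase

variable {k K : Type} [Field k] [Field K] [Algebra k K]

/-- `aeval_mem_subalgebra`: Auxiliary step of this node's calculus, VERBATIM from the lens file (see the module docstring); the statement is its type. [folklore] -/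
theorem aeval_mem_subalgebra (R : Subalgebra k K) {y : K} (hy : y ∈ R) (f : Polynomial k) :
    Polynomial.aeval y f ∈ R := by
  have h : Polynomial.aeval y f = R.val (Polynomial.aeval (⟨y, hy⟩ : R) f) := by
    rw [← Polynomial.aeval_algHom_apply]; rfl
  rw [h]
  exact (Polynomial.aeval (⟨y, hy⟩ : R) f).2

/-- `k(y) ⊆ R_{𝔪_O ∩ R}` for `y ∈ R` of transcendental residue: denominators `s(y)`, `s ≠ 0`,
are `O`-units. [folklore] -/
theorem adjoin_simple_subset_locAtCentre (O : ValuationSubring K) (R : Subalgebra k K) {y : K}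
    (hyR : y ∈ R) (hy : ∀ f : Polynomial k, f ≠ 0 → O.valuation (Polynomial.aeval y f) = 1) :
    ((IntermediateField.adjoin k {y} : IntermediateField k K) : Set K) ⊆
      locAtCentre R.toSubring O := by
  classical
  intro x hx
  rw [SetLike.mem_coe, IntermediateField.mem_adjoin_simple_iff] at hx
  obtain ⟨r, s, rfl⟩ := hx
  by_cases hs : s = 0
  · rw [hs, map_zero, div_zero]
    exact (locAtCentre R.toSubring O).zero_mem
  exact ⟨_, aeval_mem_subalgebra R hyR r, _, aeval_mem_subalgebra R hyR s, hy s hs, rfl⟩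

/-- **K2 · RE-BASING.** `LURel d → TransResidueLU (d + 1)`: if `y ∈ O` has transcendental
residue, then `k' = k(y) ⊆ R[y]_{𝔪_O ∩ R[y]}` for every model `R ⊆ O`, `tr.deg_{k'} K ≤ d`, and a
regular model over `k'` (from `LURel d`) descends to one over `k` with the same local ring at the
centre (sandwich `A ⊆ A' ⊆ A_{𝔪_O ∩ A}`). [folklore] -/
theorem transResidueLU_succ {d : ℕ} (hL : LURel d) : TransResidueLU (d + 1) := by
  intro p hp k K _ _ _ _ hd O hyex R hRfg hRfr hRO
  obtain ⟨y, hyO, hy⟩ := hyex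
  classical
  have hk : ∀ c : k, algebraMap k K c ∈ O := algebraMap_mem_of_le O R hRO
  have hty : Transcendental k y := transcendental_of_valuation_aeval O hy
  -- enlarge the model by `y`
  let R₁ : Subalgebra k K := Algebra.adjoin k (insert y (R : Set K))
  have hRR₁ : R ≤ R₁ := le_adjoin_insert R y
  have hyR₁ : y ∈ R₁ := mem_adjoin_insert R y
  have hR₁O : R₁.toSubring ≤ O.toSubring := adjoin_insert_toSubring_le O.toSubring R hRO hyO
  have hR₁fg : R₁.FG := fg_adjoin_insert hRfg y
  have hR₁fr : IsFractionRing R₁ K := isFractionRing_of_le hRR₁ hRfr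
  -- the new ground field `k' = k(y) ⊆ (R₁)_{𝔪_O ∩ R₁}`
  let k' : IntermediateField k K := IntermediateField.adjoin k {y}
  have hyk' : y ∈ k' := IntermediateField.mem_adjoin_simple_self k y
  have hk'loc : (k' : Set K) ⊆ locAtCentre R₁.toSubring O :=
    adjoin_simple_subset_locAtCentre O R₁ hyR₁ hy
  haveI : CharP k' p := charP_of_injective_algebraMap (algebraMap k k').injective p
  have hd' : Algebra.trdeg k' K ≤ d := trdeg_le_of_transcendental k' hyk' hty hd
  -- base change `R₁' = k'[R₁]`, same local ring at the centre
  let R₁' : Subalgebra k' K := Algebra.adjoin k' (R₁ : Set K)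
  have hR₁R₁' : R₁.toSubring ≤ R₁'.toSubring := fun x hx => Algebra.subset_adjoin hx
  let L₁ : Subalgebra k' K :=
    { locAtCentre R₁.toSubring O with algebraMap_mem' := fun c => hk'loc c.2 }
  have hR₁'loc : R₁'.toSubring ≤ locAtCentre R₁.toSubring O := by
    change R₁' ≤ L₁
    exact Algebra.adjoin_le (le_locAtCentre R₁.toSubring O)
  have hR₁'O : R₁'.toSubring ≤ O.toSubring := hR₁'loc.trans (locAtCentre_le hR₁O)
  have hR₁'fg : R₁'.FG := fg_adjoin_of_fg k' hR₁fg
  have hR₁'fr : IsFractionRing R₁' K :=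
    isFractionRing_of_subset (A := R₁) Algebra.subset_adjoin hR₁fr
  -- relative local uniformization over `k'`, one rung down
  obtain ⟨A', h', hR₁'A', hA'fg, hregA'⟩ := hL p hp k' K hd' O R₁' hR₁'fg hR₁'fr hR₁'O
  -- descent to `k`
  obtain ⟨G, hG⟩ := hA'fg
  obtain ⟨T, hT⟩ := hR₁fg
  have hTR₁ : ∀ x ∈ (T : Set K), x ∈ R₁ := fun x hx => by
    rw [← hT]
    exact Algebra.subset_adjoin hx
  let A : Subalgebra k K := Algebra.adjoin k ((T : Set K) ∪ (G : Set K))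
  have hAfg : A.FG := ⟨T ∪ G, by rw [Finset.coe_union]⟩
  have hR₁A : R₁ ≤ A := by
    rw [← hT]
    exact Algebra.adjoin_le fun x hx => Algebra.subset_adjoin (Or.inl hx)
  have hRA : R ≤ A := hRR₁.trans hR₁A
  let A'k : Subalgebra k K :=
    { A'.toSubring with
      algebraMap_mem' := fun c => by
        rw [IsScalarTower.algebraMap_apply k k' K]
        exact A'.algebraMap_mem _ }
  have hAA' : A.toSubring ≤ A'.toSubring := by
    change A ≤ A'k
    refine Algebra.adjoin_le ?_
    rintro x (hx | hx)
    · exact hR₁'A' (hR₁R₁' (hTR₁ x hx))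
    · change x ∈ A'
      rw [← hG]
      exact Algebra.subset_adjoin hx
  have h : A.toSubring ≤ O.toSubring := hAA'.trans h'
  have hR₁A_sub : R₁.toSubring ≤ A.toSubring := fun x hx => hR₁A hx
  let L : Subalgebra k' K :=
    { locAtCentre A.toSubring O with
      algebraMap_mem' := fun c => locAtCentre_mono O hR₁A_sub (hk'loc c.2) }
  have hA'loc : A'.toSubring ≤ locAtCentre A.toSubring O := by
    change A' ≤ L
    rw [← hG]
    refine Algebra.adjoin_le fun x hx => ?_
    change x ∈ locAtCentre A.toSubring O
    exact le_locAtCentre A.toSubring O (Algebra.subset_adjoin (Or.inr hx))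
  exact ⟨A, h, hRA, hAfg, (isRegularLocalRing_centre_iff_of_le_of_le h h' hAA' hA'loc).mpr hregA'⟩

end Rebase

/-! ## 5. Composite valuations: `LURel d → CompositeLU (d + 1)` -/

section Composite

variable {k K : Type} [Field k] [Field K] [Algebra k K]

/-- **Residue transcendence drop.** For a non-trivial valuation ring `O₁` of `K/k` with
`tr.deg_k K ≤ d + 1` and a finitely generated model `A₁ ⊆ O₁`, the fraction field `κ` of the image
of `A₁` in the residue field of `O₁` has `tr.deg_k κ ≤ d`: the centre of `O₁` on `A₁` is a non-zero
prime (it contains the denominator of any element of `K ∖ O₁`), so `dim φ(A₁) + 1 ≤ dim A₁ ≤ d + 1`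
(`ringKrullDim_succ_le_of_surjective`), and `tr.deg_k κ = dim φ(A₁)` for the affine domain `φ(A₁)`. [folklore] -/
theorem trdeg_residue_le {d : ℕ} (hd : Algebra.trdeg k K ≤ (d + 1 : ℕ))
    (O₁ : ValuationSubring K) (hO₁ : O₁ ≠ ⊤) (A₁ : Subalgebra k K)
    (hA₁ : A₁.toSubring ≤ O₁.toSubring) (hA₁fg : A₁.FG) [hfrac₁ : IsFractionRing A₁ K]
    (κ : Type) [Field κ] [Algebra k κ] (ι : κ →+* ResidueField O₁) (φ : A₁ →ₐ[k] κ)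
    (hφ : ∀ a : A₁, ι (φ a) = residue O₁ ⟨(a : K), hA₁ a.2⟩) (hfr : IsFractionRing φ.range κ) :
    Algebra.trdeg k κ ≤ d := by
  classical
  -- an element of `K` outside `O₁`, written as a fraction over `A₁`
  obtain ⟨w, hw⟩ : ∃ w : K, w ∉ O₁ := by
    by_contra hcon
    push Not at hcon
    exact hO₁ (eq_top_iff.mpr fun x _ => hcon x)
  obtain ⟨a, b, hb0, hab⟩ := IsFractionRing.div_surjective (A := A₁) w
  -- its denominator `b` lies in the centre of `O₁` on `A₁`
  have hbm : (⟨(b : K), hA₁ b.2⟩ : O₁) ∈ maximalIdeal O₁ := by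
    by_contra hbu
    rw [IsLocalRing.mem_maximalIdeal, mem_nonunits_iff, not_not] at hbu
    have hv1 : O₁.valuation (b : K) = 1 := (O₁.valuation_eq_one_iff _).mp hbu
    have hbinv : ((b : K))⁻¹ ∈ O₁ := by
      rw [← O₁.valuation_le_one_iff, map_inv₀, hv1, inv_one]
    apply hw
    rw [← hab]
    change (a : K) / (b : K) ∈ O₁
    rw [div_eq_mul_inv]
    exact mul_mem (hA₁ a.2) hbinv
  have hφb : φ b = 0 := by
    apply ι.injective
    rw [hφ, map_zero, IsLocalRing.residue_eq_zero_iff]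
    exact hbm
  -- Krull dimension drops along `A₁ ↠ φ(A₁)`
  let f : A₁ →+* φ.range := (φ.rangeRestrict : A₁ →ₐ[k] φ.range).toRingHom
  have hf : Function.Surjective f := fun y => by
    obtain ⟨x, hx⟩ := (AlgHom.mem_range φ).mp y.2
    exact ⟨x, Subtype.ext hx⟩
  have hfb : f b = 0 := Subtype.ext hφb
  have h1 : ringKrullDim φ.range + 1 ≤ ringKrullDim A₁ :=
    ringKrullDim_succ_le_of_surjective f hf hb0 hfb
  have h2 : ringKrullDim A₁ ≤ (d + 1 : ℕ) := ringKrullDim_le_of_fg_of_trdeg_le A₁ hA₁fg hd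
  -- `tr.deg_k κ = dim φ(A₁)` for the affine domain `φ(A₁)` with fraction field `κ`
  have hfgr : φ.range.FG := by
    have h := ((Subalgebra.fg_top A₁).mpr hA₁fg).map φ
    rwa [Algebra.map_top] at h
  haveI : Algebra.FiniteType k φ.range := φ.range.fg_iff_finiteType.mp hfgr
  haveI := hfr
  obtain ⟨n, hn, htr⟩ := exists_ringKrullDim_eq_and_trdeg_eq k φ.range
  rw [trdeg_eq_trdeg_of_isFractionRing φ.range, htr]
  rw [hn] at h1
  have h3 : ((n + 1 : ℕ) : WithBot ℕ∞) ≤ ((d + 1 : ℕ) : WithBot ℕ∞) := by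
    have h := h1.trans h2
    exact_mod_cast h
  have h4 : n + 1 ≤ d + 1 := by exact_mod_cast h3
  exact_mod_cast (by omega : n ≤ d)

/-- **K3 · COMPOSITE VALUATIONS.** `LURel d → CompositeLU (d + 1)`: for `k ⊆ O < O₁ < K` the
coarsening `O₁` has transcendental residue (`exists_transResidue_of_lt`), so it is uniformized by
RE-BASING one rung down (`transResidueLU_succ`); the residue valuation `O/𝔪_{O₁}` lives on residue
fields of transcendence degree `≤ d` (`trdeg_residue_le`), uniformized one rung down; the two are
patched by Novacoski–Spivakovsky Cor. 2.14, Cor. 2.17 and §3.1 (tree theorems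
`novacoskiSpivakovsky2014_cor214/_cor217/_step`). [folklore] -/
theorem compositeLU_succ {d : ℕ} (hL : LURel d) : CompositeLU (d + 1) := by
  intro p hp k K _ _ _ _ hd O hcomp R hR hfrac hRO
  obtain ⟨O₁, hO, hne, hne_top⟩ := hcomp
  classical
  have hk : ∀ c : k, algebraMap k K c ∈ O := algebraMap_mem_of_le O R hRO
  -- `ν₁`: the coarsening has transcendental residue — re-basing, one rung down
  have ih₁ : RelLocalUniformization k K O₁ :=
    transResidueLU_succ hL p hp k K hd O₁ (exists_transResidue_of_lt hO hne hk)
  obtain ⟨A₁, hA₁, hRA₁, hA₁fg, hreg₁⟩ :=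
    novacoskiSpivakovsky2014_cor214 O O₁ hO R hR hfrac hRO (ih₁ R hR hfrac (hRO.trans hO))
  haveI := hfrac
  haveI hfrac₁ : IsFractionRing A₁ K := isFractionRing_subalgebra_of_le R A₁ hRA₁
  -- `ν₂`: the residue valuation lives in transcendence degree `≤ d` — one rung down
  have ih₂' : ∀ (κ : Type) [Field κ] [Algebra k κ] (ι : κ →+* ResidueField O₁) (φ : A₁ →ₐ[k] κ),
      (∀ a : A₁, ι (φ a) = residue O₁ ⟨(a : K), (hA₁.trans hO) a.2⟩) →
      IsFractionRing φ.range κ →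
      ∃ (B : Subalgebra k κ)
        (hB : B.toSubring ≤ ((residueValuationSubring O O₁ hO).comap ι).toSubring),
        φ.range ≤ B ∧ B.FG ∧
        IsRegularLocalRing (Localization.AtPrime
          ((maximalIdeal ((residueValuationSubring O O₁ hO).comap ι)).comap
            (Subring.inclusion hB))) := by
    intro κ _ _ ι φ hφ hfr
    have hfg : φ.range.FG := by
      have h := ((Subalgebra.fg_top A₁).mpr hA₁fg).map φ
      rwa [Algebra.map_top] at h
    have hle : φ.range.toSubring ≤ ((residueValuationSubring O O₁ hO).comap ι).toSubring := by
      intro z hz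
      obtain ⟨a, rfl⟩ := (AlgHom.mem_range φ).mp (show z ∈ φ.range from hz)
      change φ a ∈ (residueValuationSubring O O₁ hO).comap ι
      rw [ValuationSubring.mem_comap, hφ]
      exact (residue_mem_residueValuationSubring_iff O O₁ hO _).mpr (hA₁ a.2)
    have hκ : Algebra.trdeg k κ ≤ d :=
      trdeg_residue_le hd O₁ hne_top A₁ (hA₁.trans hO) hA₁fg κ ι φ hφ hfr
    exact hL p hp k κ hκ _ φ.range hfg hfr hle
  obtain ⟨A₂, hA₂, hA₁₂, hA₂fg, hreg₂, hreg₂'⟩ :=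
    novacoskiSpivakovsky2014_cor217 O O₁ hO A₁ hA₁ hA₁fg hfrac₁ hreg₁ ih₂'
  haveI hfrac₂ : IsFractionRing A₂ K := isFractionRing_subalgebra_of_le A₁ A₂ hA₁₂
  obtain ⟨A₃, hA₃, hA₂₃, hA₃fg, hreg₃⟩ :=
    novacoskiSpivakovsky2014_step O O₁ hO A₂ hA₂ hA₂fg hfrac₂ hreg₂ hreg₂'
  exact ⟨A₃, hA₃, hRA₁.trans (hA₁₂.trans hA₂₃), hA₃fg, hreg₃⟩

end Composite

/-! ## 6. The ladder: split, floor, iteration -/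

/-- **K4 · THE SPLIT.** One rung up costs exactly the archimedean core: a valuation ring of
`K/k` is `K` itself, or has an element of transcendental residue, or is composite, or is a
rank-one zero-dimensional one. [folklore] -/
theorem luRel_succ {d : ℕ} (hL : LURel d) (hA : ArchCoreLU (d + 1)) : LURel (d + 1) := by
  intro p hp k K _ _ _ _ hd O R hR hfrac hRO
  have hk : ∀ c : k, algebraMap k K c ∈ O := algebraMap_mem_of_le O R hRO
  by_cases htop : O = ⊤
  · subst htop
    exact relLocalUniformization_top R hR hfrac hRO
  by_cases htr : ∃ y ∈ O, ∀ f : Polynomial k, f ≠ 0 → O.valuation (Polynomial.aeval y f) = 1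
  · exact transResidueLU_succ hL p hp k K hd O htr R hR hfrac hRO
  by_cases hcomp : ∃ O₁ : ValuationSubring K, O ≤ O₁ ∧ O₁ ≠ O ∧ O₁ ≠ ⊤
  · exact compositeLU_succ hL p hp k K hd O hcomp R hR hfrac hRO
  have h2 : ∀ S : ValuationSubring K, O ≤ S → S = O ∨ S = ⊤ := by
    intro S hS
    by_contra hcon
    push Not at hcon
    exact hcomp ⟨S, hS, hcon.1, hcon.2⟩
  exact hA p hp k K hd O (nonempty_rankOne_of_overrings O htop h2)
    (zeroDim_of_not_exists O hk htr) R hR hfrac hRO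

/-- The rung recursion, as an equivalence. [folklore] -/
theorem luRel_succ_iff (d : ℕ) : LURel (d + 1) ↔ LURel d ∧ ArchCoreLU (d + 1) :=
  ⟨fun h => ⟨luRel_mono (Nat.le_succ d) h, archCoreLU_of_luRel h⟩,
    fun h => luRel_succ h.1 h.2⟩

/-- **K6 · FLOOR (in print, piece 0).** Cossart–Piltant 2019: local uniformization in dimension
`≤ 3`, positive characteristic, arbitrary ground field (tree transfer
`CossartPiltant2019LU3.relLocalUniformization`). [folklore] -/
theorem luRel_three_of_cp (hCP : CossartPiltant2019LU3.{0}) : LURel 3 :=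
  fun _ _ k K _ _ _ _ hd O => CossartPiltant2019LU3.relLocalUniformization hCP k K hd O

/-- `luRel_of_le_three`: Auxiliary step of this node's calculus, VERBATIM from the lens file (see the module docstring); the statement is its type. [folklore] -/
theorem luRel_of_le_three (hCP : CossartPiltant2019LU3.{0}) {d : ℕ} (hd : d ≤ 3) : LURel d :=
  luRel_mono hd (luRel_three_of_cp hCP)

/-- **K7 · ITERATION.** Above the Cossart–Piltant floor the whole ladder reduces to its archimedean
cores. [folklore] -/
theorem luRel_of_archCore (hCP : CossartPiltant2019LU3.{0}) (hA : ∀ d, 4 ≤ d → ArchCoreLU d) :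
    ∀ d, LURel d := by
  intro d
  induction d with
  | zero => exact luRel_of_le_three hCP (by omega)
  | succ d ih =>
    by_cases h : d + 1 ≤ 3
    · exact luRel_of_le_three hCP h
    · exact luRel_succ ih (hA (d + 1) (by omega))

/-- DECIDED-MOD-CP2019 cell at the first open rung: fourfold valuations with an element of
transcendental residue. [folklore] -/
theorem transResidueLU_four_of_cp (hCP : CossartPiltant2019LU3.{0}) : TransResidueLU 4 :=
  transResidueLU_succ (luRel_three_of_cp hCP)

/-- DECIDED-MOD-CP2019 cell at the first open rung: composite fourfold valuations. [folklore] -/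
theorem compositeLU_four_of_cp (hCP : CossartPiltant2019LU3.{0}) : CompositeLU 4 :=
  compositeLU_succ (luRel_three_of_cp hCP)

/-- The LOCATED RESIDUAL: rung 4 is exactly its archimedean core (mod the floor). [folklore] -/
theorem luRel_four_iff_archCore_four (hCP : CossartPiltant2019LU3.{0}) : LURel 4 ↔ ArchCoreLU 4 :=
  ⟨archCoreLU_of_luRel, fun h => luRel_succ (luRel_three_of_cp hCP) h⟩

end Summit.ResolutionOfSingularities.ResolutionOfSingularities.Theorems.ToricLadder
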